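import Summits.Ventures.YMGap.RobustBall.PerturbedReflectionCovariance
import HarnessLib

/-!
# Venture YMGap, track ROBUST-BALL — ONE STATE, step 18: covariance under CHARACTER-PRESERVING AUTOMORPHISMS of the gauge group
# (charge-conjugation type symmetries); the one state is invariant under them

HONEST FRAMING. WHAT THIS IS: a venture file (cell `pub-ymgap`, track Y2 ROBUST-BALL, seat ds-3, theorems only). Let `σ : G ≃* G` be a
continuous automorphism of the compact gauge group (with continuous inverse) preserving the plaquette character, `Re tr ρ(σ g) = Re tr ρ(g)`
(for `SU(N)` and the fundamental representation: every inner automorphism, and COMPLEX CONJUGATION `g ↦ ḡ` — lattice charge conjugation;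
the conjugation automorphism itself is not constructed in this file). Acting linkwise, `U ↦ σ ∘ U`, is a twisted relabelling with trivial
relabelling (`Covariance.tilted_glueWith_map_twist` of `PerturbedReflectionCovariance.lean`) and `σ` preserves the Haar probability measure
(Mathlib `MonoidHom.measurePreserving`: continuous surjective endomorphism of a compact group). Hence: the boundary Wilson action is
`σ`-invariant (`wilsonBoundaryAction_autConfig`), the tier-1 perturbed specification of a member with `σ`-invariant finite-volume Hamiltonians
is `σ`-covariant (`perturbedYM_map_autConfig`), its DLR set is `σ`-stable (`map_autConfig_mem_perturbedGibbsMeasures`), and ★ in the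
uniqueness regime THE ONE STATE IS `σ`-INVARIANT (`oneState_autInvariant_of_perturbedMassGapAt`; Wilson, every `d`, `N`:
`oneState_autInvariant_of_massGapAt`). WHAT THIS IS NOT: no concrete outer automorphism is instantiated (the `SU(N)` complex conjugation as
a `MulEquiv` is left to a later file); lattice statements only, nothing about the continuum limit or the Clay Millennium problem.

References: H.-O. Georgii (2011), §5.1; E. Seiler, LNP 159 (1982), Ch. 1; the track's `PerturbedReflectionCovariance.lean`.
-/

noncomputable section

open MeasureTheory Filter Function
open Literature.Probability.LatticeModels hiding configShift configShift_apply
open Literature.MathematicalPhysics.QuantumLattice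
open Literature.MathematicalPhysics.QuantumFieldTheory hiding ZdEdge Site

namespace Summit.Ventures.YMGap.RobustBall

section Aut

variable {d N : ℕ} {G : Type*} [Group G] (ρ : G →* Matrix (Fin N) (Fin N) ℂ)

/-- The plaquette holonomy of `σ ∘ U` is `σ` of the plaquette holonomy (a group automorphism respects products and inverses).
[folklore] -/
theorem plaquetteHolonomyZd_autConfig (σ : G ≃* G) (U : LGConfig d G) (x : Site d) (i j : Fin d) :
    plaquetteHolonomyZd (fun e => σ (U e)) x i j = σ (plaquetteHolonomyZd U x i j) := by
  simp only [plaquetteHolonomyZd, map_mul, map_inv]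

/-- A character-preserving automorphism preserves every plaquette observable. [folklore] -/
theorem plaquetteObs_autConfig (σ : G ≃* G) (hρσ : ∀ g, (ρ (σ g)).trace.re = (ρ g).trace.re) (x : Site d) (i j : Fin d)
    (U : LGConfig d G) : plaquetteObs ρ x i j (fun e => σ (U e)) = plaquetteObs ρ x i j U := by
  simp only [plaquetteObs, plaquetteHolonomyZd_autConfig, hρσ]

/-- **The boundary Wilson action is invariant under a character-preserving automorphism acting linkwise.** [folklore] -/
theorem wilsonBoundaryAction_autConfig (σ : G ≃* G) (hρσ : ∀ g, (ρ (σ g)).trace.re = (ρ g).trace.re)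
    (Λ : Finset (ZdEdge d)) (U : LGConfig d G) :
    wilsonBoundaryAction ρ Λ (fun e => σ (U e)) = wilsonBoundaryAction ρ Λ U := by
  unfold wilsonBoundaryAction
  exact Finset.sum_congr rfl fun p _ => by rw [plaquetteObs_autConfig ρ σ hρσ]

variable [TopologicalSpace G] [IsTopologicalGroup G] [CompactSpace G] [MeasurableSpace G] [BorelSpace G]

/-- **A continuous automorphism with continuous inverse preserves the Haar probability measure** (Mathlib
`MonoidHom.measurePreserving`: continuous surjective endomorphism of a compact group; equal total masses). [folklore] -/
theorem measurePreserving_aut_haarProbability (σ : G ≃* G) (hσ : Continuous σ) :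
    MeasurePreserving σ (haarProbability G) (haarProbability G) :=
  MonoidHom.measurePreserving (f := σ.toMonoidHom) hσ σ.surjective rfl

variable [SecondCountableTopology G]

/-- ★ **Covariance of the tier-1 perturbed specification under a character-preserving automorphism acting linkwise**: if the member's
finite-volume Hamiltonians are invariant, `H^W_Λ(σ ∘ U) = H^W_Λ(U)`, then `γ^W_Λ(· | η) ∘ (σ∘·)⁻¹ = γ^W_Λ(· | σ ∘ η)`. [folklore] -/
theorem perturbedYM_map_autConfig (hρ : Continuous ρ) (β : ℝ) {W : Potential (ZdEdge d) G} (hWc : ∀ X, Continuous (W X))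
    (supp : Finset (ZdEdge d) → Finset (Finset (ZdEdge d))) (Λ : Finset (ZdEdge d)) (σ : G ≃* G) (hσ : Continuous σ)
    (hσ' : Continuous σ.symm) (hρσ : ∀ g, (ρ (σ g)).trace.re = (ρ g).trace.re)
    (hH : ∀ U : LGConfig d G, hamiltonianIn W supp Λ (fun e => σ (U e)) = hamiltonianIn W supp Λ U) (η : LGConfig d G) :
    (perturbedYM ρ β W supp Λ η).map (fun U e => σ (U e)) = perturbedYM ρ β W supp Λ (fun e => σ (η e)) := by
  classical
  let σm : G ≃ᵐ G :=
    { toEquiv := σ.toEquiv, measurable_toFun := hσ.measurable, measurable_invFun := hσ'.measurable }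
  let T : LGConfig d G ≃ᵐ LGConfig d G := MeasurableEquiv.arrowCongr' (Equiv.refl (ZdEdge d)) σm
  have hT : ∀ (U : LGConfig d G) (x : ZdEdge d), T U x = (fun _ : ZdEdge d => σm) x (U ((Equiv.refl (ZdEdge d)).symm x)) :=
    fun U x => rfl
  have hφ : ∀ x : ZdEdge d, MeasurePreserving ((fun _ : ZdEdge d => σm) x) (haarProbability G) (haarProbability G) :=
    fun _ => measurePreserving_aut_haarProbability σ hσ
  have hmap : Λ.map (Equiv.refl (ZdEdge d)).toEmbedding = Λ := by simp
  have hcov : ∀ U : LGConfig d G, perturbedEnergy ρ β W supp (Λ.map (Equiv.refl (ZdEdge d)).toEmbedding) (T U) =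
      perturbedEnergy ρ β W supp Λ U := fun U => by
    rw [hmap]
    show perturbedEnergy ρ β W supp Λ (fun e => σ (U e)) = _
    simp only [perturbedEnergy, wilsonBoundaryAction_autConfig ρ σ hρσ, hH]
  have key := Covariance.tilted_glueWith_map_twist _ _ (continuous_perturbedEnergy ρ hρ β hWc supp Λ)
    (continuous_perturbedEnergy ρ hρ β hWc supp _) Λ T (Equiv.refl (ZdEdge d)) _ hT hφ hcov η
  rw [hmap] at key
  exact key

/-- ★ **Tier 1: the image of a DLR state of a `σ`-symmetric member under `σ` acting linkwise is a DLR state.** [folklore] -/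
theorem map_autConfig_mem_perturbedGibbsMeasures [T2Space G] (hρ : Continuous ρ) (β : ℝ) {W : Potential (ZdEdge d) G}
    (hWc : ∀ X, Continuous (W X)) (hdep : ∀ X, DependsOn (W X) (↑X : Set (ZdEdge d)))
    {supp : Finset (ZdEdge d) → Finset (Finset (ZdEdge d))} (hsupp : W.IsSupportedBy supp) (σ : G ≃* G) (hσ : Continuous σ)
    (hσ' : Continuous σ.symm) (hρσ : ∀ g, (ρ (σ g)).trace.re = (ρ g).trace.re)
    (hH : ∀ (Λ : Finset (ZdEdge d)) (U : LGConfig d G), hamiltonianIn W supp Λ (fun e => σ (U e)) = hamiltonianIn W supp Λ U)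
    {μ : Measure (LGConfig d G)} (hμ : μ ∈ perturbedGibbsMeasures (d := d) ρ β W supp) :
    μ.map (fun U e => σ (U e)) ∈ perturbedGibbsMeasures (d := d) ρ β W supp := by
  classical
  let σm : G ≃ᵐ G :=
    { toEquiv := σ.toEquiv, measurable_toFun := hσ.measurable, measurable_invFun := hσ'.measurable }
  let T : LGConfig d G ≃ᵐ LGConfig d G := MeasurableEquiv.arrowCongr' (Equiv.refl (ZdEdge d)) σm
  have hmap : ∀ Λ : Finset (ZdEdge d), Λ.map (Equiv.refl (ZdEdge d)).toEmbedding = Λ := fun Λ => by simp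
  exact Covariance.map_equiv_mem_gibbsMeasures
    (isSpecification_perturbedYM ρ hρ β (fun X => ⟨hdep X, (hWc X).measurable⟩)
      (fun X => exists_bound_of_continuous (hWc X)) hsupp)
    T (Equiv.refl (ZdEdge d))
    (fun Λ η => by rw [hmap]; exact perturbedYM_map_autConfig ρ hρ β hWc supp Λ σ hσ hσ' hρσ (hH Λ) η) hμ

end Aut

section Currencies

variable {d N : ℕ}

/-- ★★ **TIER 1: THE ONE STATE OF A `σ`-SYMMETRIC MEMBER IS `σ`-INVARIANT** for every continuous automorphism `σ` of `SU(N)` (with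
continuous inverse) preserving the fundamental character `Re tr`, under `PerturbedMassGapAt d N β W supp` and `σ`-invariance of the
finite-volume Hamiltonians: `μ ∘ (σ∘·)⁻¹ = μ`. [folklore] -/
theorem oneState_autInvariant_of_perturbedMassGapAt {β : ℝ} {W : Potential (ZdEdge d) (SUN N)}
    {supp : Finset (ZdEdge d) → Finset (Finset (ZdEdge d))} (hgap : PerturbedMassGapAt d N β W supp)
    (hWc : ∀ X, Continuous (W X)) (hdep : ∀ X, DependsOn (W X) (↑X : Set (ZdEdge d))) (hsupp : W.IsSupportedBy supp)
    (σ : SUN N ≃* SUN N) (hσ : Continuous σ) (hσ' : Continuous σ.symm)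
    (hρσ : ∀ g, ((fundamentalRep (Fin N)) (σ g)).trace.re = ((fundamentalRep (Fin N)) g).trace.re)
    (hH : ∀ (Λ : Finset (ZdEdge d)) (U : LGConfig d (SUN N)),
      hamiltonianIn W supp Λ (fun e => σ (U e)) = hamiltonianIn W supp Λ U) :
    ∃ μ : Measure (LGConfig d (SUN N)),
      perturbedGibbsMeasures (d := d) (fundamentalRep (Fin N)) ((N : ℝ) * β) W supp = {μ} ∧
        μ.map (fun U e => σ (U e)) = μ := by
  haveI : SecondCountableTopology (Matrix (Fin N) (Fin N) ℂ) :=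
    inferInstanceAs (SecondCountableTopology (Fin N → Fin N → ℂ))
  haveI : SecondCountableTopology (SUN N) := Topology.IsEmbedding.subtypeVal.secondCountableTopology
  obtain ⟨hsub, ⟨μ, hμ⟩⟩ := hgap.1
  exact ⟨μ, Set.eq_singleton_iff_unique_mem.2 ⟨hμ, fun ν hν => hsub hν hμ⟩,
    hsub (map_autConfig_mem_perturbedGibbsMeasures _ (continuous_fundamentalRep (Fin N)) _ hWc hdep hsupp σ hσ hσ' hρσ hH hμ) hμ⟩

/-- ★★ **WILSON ACTION (every `d`, `N`): under `MassGapAt d N β` the one state is invariant under every continuous character-preserving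
automorphism of `SU(N)` acting linkwise** (inner automorphisms = global gauge rotations; complex conjugation = lattice charge conjugation,
once written as a `MulEquiv`). [folklore] -/
theorem oneState_autInvariant_of_massGapAt {β : ℝ} (hgap : MassGapAt d N β) (σ : SUN N ≃* SUN N) (hσ : Continuous σ)
    (hσ' : Continuous σ.symm) (hρσ : ∀ g, ((fundamentalRep (Fin N)) (σ g)).trace.re = ((fundamentalRep (Fin N)) g).trace.re) :
    ∃ μ : Measure (LGConfig d (SUN N)),
      ymGibbsMeasures (d := d) (fundamentalRep (Fin N)) ((N : ℝ) * β) = {μ} ∧ μ.map (fun U e => σ (U e)) = μ := by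
  have h0 : PerturbedMassGapAt d N β 0 (fun _ => ∅) := (perturbedMassGapAt_zero_iff β _).2 hgap
  obtain ⟨μ, hG, hP⟩ := oneState_autInvariant_of_perturbedMassGapAt h0 (fun _ => continuous_const)
    (fun _ _ _ _ => rfl) (fun _ _ _ h => (h rfl).elim) σ hσ hσ' hρσ (fun Λ U => by simp [hamiltonianIn])
  refine ⟨μ, ?_, hP⟩
  rwa [perturbedGibbsMeasures_zero] at hG

end Currencies

end Summit.Ventures.YMGap.RobustBall

end
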